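import Mathlib.RingTheory.AdjoinRoot
import Mathlib.Algebra.DualNumber
import Mathlib.RingTheory.Artinian.Module
import Mathlib.RingTheory.LocalRing.RingHom.Basic
import Mathlib.Algebra.Polynomial.Inductions
import HarnessLib

/-!
# The T¹-lifting theorem (Ran–Kawamata–Fantechi–Manetti): the test algebras and the (H4) case

Ran [Ran1992DeformationsNegativeCanonical] and Kawamata [Kawamata1992UnobstructedDeformations] proved that a
pro-representable deformation functor with the *T¹-lifting property* is unobstructed (char `k = 0`); Fantechi–Manetti
[FantechiManetti1999T1Lifting, Thm A / Thm A′] removed the pro-representability hypothesis, see also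
[FantechiManetti1998ObstructionCalculus, Def. 6.13, Thm. 6.14, Cor. 6.15]. This file formalises, AS PRINTED in
[FantechiManetti1999T1Lifting] (authors' version, pp. 1–3; the general case is pp. 3–5):

* the test algebras `A_n = k[t]/(t^{n+1})`, `B_n = k[x,y]/(x^{n+1}, y²)` (Def. 1.1) and the auxiliary algebra
  `C_n = k[x,y]/(x^{n+1}, xⁿy, y²)` (p. 3, l. 5), modelled as `AdjoinRoot (X^(n+1))`, the dual numbers over it, and
  the quotient of the latter by the principal ideal `(xⁿy)`; the maps of Def. 1.1, `i : A_{n+1} → A_n` (`t ↦ t`),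
  `bA : B_n → A_n` (`x ↦ t, y ↦ 0`), `β : B_{n+1} → B_n`; the maps of p. 3, `j : B_n → C_n`, `gC : C_{n+1} → A_{n+1}`
  (`g(x, y) = (t, 0)`), `jB : C_{n+1} → B_n`, and Fantechi–Manetti's `f(t) = x + y` (p. 3, l. 10) as
  `fB : A_{m+1} → B_m`, `fC : A_m → C_m`;
* that these algebras are local Artinian `k`-algebras with residue field `k` (objects of `Art_k`), that
  `i : A_{n+1} → A_n` and `j : B_n → C_n` are small extensions (`isSmallExtension_i`, `isSmallExtension_j`);
* **the two cartesian diagrams of p. 3**: `C_{n+1} ≅ B_n ×_{A_n} A_{n+1}` (l. 13–19, any characteristic;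
  `isCartesian_gC_jB`) and `A_{m+1} ≅ B_m ×_{C_m} A_m` (l. 21–23, characteristic zero; `isCartesian_fB_i`) — the
  ring-theoretic heart of Kawamata's proof;
* functors of Artin rings `F : Art_k → Sets` (objects bundled as `ArtAlg k`; the normalisation `F(k) = {pt}` is not
  imposed), Schlessinger's conditions (H₁) and (H₄) in the SQUARE form of [FantechiManetti1998ObstructionCalculus,
  Def. 2.7] — «(∗) surjective / bijective if `A'' → A` is a principal small extension», `A' → A` arbitrary; Schlessinger's
  own (H₄) [Schlessinger1968, p. 213] has both factors equal to the same small extension and is equivalent under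
  (H₁), (H₂) ([Schlessinger1968, (2.15)], [FantechiManetti1998ObstructionCalculus, Cor. 6.3]); the square form is the
  one [FantechiManetti1999T1Lifting, p. 3] uses; the functor of points `h_R` of any `k`-algebra satisfies it
  (`ArtinFunctor.points_H4`) — THE T¹-LIFTING PROPERTY (Def. 1.1,
  `ArtinFunctor.T1Lifting`), its form under (H₄) — «`F(B_n) → F(C_n)` is onto for every `n`» (p. 3, l. 20–21;
  `ArtinFunctor.T1LiftingH4`, derived from Def. 1.1 under (H₄) in `map_j_succ_surjective_of_t1Lifting`, and giving it
  back under (H₁) in `t1Lifting_of_t1LiftingH4`) — and the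
  theorem the source states in one sentence (p. 3, l. 21–25): *«The cartesian diagram (in characteristic zero) …
  together with condition (H1) immediately implies that `F(A_{m+1}) → F(A_m)` is surjective and the theorem; in fact,
  this is essentially Kawamata's proof.»* — `map_i_surjective_of_map_j_surjective` (one index),
  `map_i_surjective_of_t1LiftingH4` ((H₁) + the (H₄)-form), and **`map_i_succ_surjective_of_t1Lifting`: a functor
  of Artin rings with (H₄) and the T¹-lifting property has `F(A_{m+1}) → F(A_m)` surjective for every `m ≥ 1`
  (char `k = 0`)** — Kawamata's Theorem 1 for functors with (H₄) (e.g. pro-representable ones).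

What is deliberately NOT here: the general case of [FantechiManetti1999T1Lifting, Thm A′] without (H₄) (Claims 1–2,
pp. 3–5, via the algebras `V_n`, `A′_n`); the passage from «`F(A_{m+1}) → F(A_m)` surjective for all `m ≥ 1`» to
«`F` smooth / unobstructed» ([FantechiManetti1998ObstructionCalculus, Lemma 5.6, Cor. 6.4, Cor. 6.15], which needs an
obstruction theory for `F`). No named facts: everything stated is proved.

## References

* B. Fantechi, M. Manetti, *On the T¹-lifting theorem*, J. Algebraic Geom. 8 (1999) 31–39 (authors' version, 7 pp.),
  Def. 0.1, Def. 1.1, p. 3. [FantechiManetti1999T1Lifting]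
* B. Fantechi, M. Manetti, *Obstruction calculus for functors of Artin rings, I*, J. Algebra 202 (1998) 541–576,
  Def. 6.13–Cor. 6.15. [FantechiManetti1998ObstructionCalculus]
* Y. Kawamata, *Unobstructed deformations — a remark on a paper of Z. Ran*, J. Algebraic Geom. 1 (1992) 183–190;
  Erratum 6 (1997) 803–804. [Kawamata1992UnobstructedDeformations]
* Z. Ran, *Deformations of manifolds with torsion or negative canonical bundle*, J. Algebraic Geom. 1 (1992)
  279–291. [Ran1992DeformationsNegativeCanonical]
* M. Schlessinger, *Functors of Artin rings*, Trans. AMS 130 (1968) 208–222: §1 (the category `C` of Artin local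
  algebras with residue field `k`), Def. 1.2 (small extension), Thm. 2.11 (H₁)–(H₃), (H₄), Remark (2.14).
  [Schlessinger1968]
-/

noncomputable section

open Polynomial TrivSqZeroExt DualNumber

universe u

namespace Literature.AlgebraicGeometry.Deformation

namespace T1Lifting

variable (k : Type u) [Field k]

/-! ### The curvilinear algebras `A_n = k[t]/(t^{n+1})` -/

/-- `A_n = k[t]/(t^{n+1})`, modelled as `AdjoinRoot (X^(n+1))`.
[cite: FantechiManetti1999T1Lifting, Def. 1.1] -/
abbrev A (n : ℕ) : Type u := AdjoinRoot ((X : k[X]) ^ (n + 1))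

/-- The class `t` of `X` in `A_n = k[t]/(t^{n+1})`. [cite: FantechiManetti1999T1Lifting, Def. 1.1] -/
abbrev t (n : ℕ) : A k n := AdjoinRoot.root ((X : k[X]) ^ (n + 1))

/-- `t^{n+1} = 0` in `A_n`. [cite: FantechiManetti1999T1Lifting, Def. 1.1] -/
theorem t_pow_succ (n : ℕ) : t k n ^ (n + 1) = 0 := by
  change AdjoinRoot.root _ ^ (n + 1) = 0
  rw [← AdjoinRoot.mk_X, ← map_pow]
  exact AdjoinRoot.mk_self

/-- `t^N = 0` in `A_n` as soon as `n < N`. [cite: FantechiManetti1999T1Lifting, Def. 1.1] -/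
theorem t_pow_eq_zero_of_lt {n N : ℕ} (h : n < N) : t k n ^ N = 0 := by
  obtain ⟨d, rfl⟩ := Nat.exists_eq_add_of_lt h
  rw [show n + d + 1 = (n + 1) + d by ring, pow_add, t_pow_succ, zero_mul]

/-- `tⁿ ≠ 0` in `A_n` (the socle generator). [cite: FantechiManetti1999T1Lifting, Def. 1.1] -/
theorem t_pow_ne_zero (n : ℕ) : t k n ^ n ≠ 0 := by
  intro h
  change AdjoinRoot.root _ ^ n = 0 at h
  rw [← AdjoinRoot.mk_X, ← map_pow, AdjoinRoot.mk_eq_zero] at h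
  have := natDegree_le_of_dvd h (pow_ne_zero n X_ne_zero)
  rw [natDegree_X_pow, natDegree_X_pow] at this
  omega

/-- `A_n ≠ 0`. [cite: FantechiManetti1999T1Lifting, Def. 1.1] -/
instance (n : ℕ) : Nontrivial (A k n) := nontrivial_of_ne _ _ (t_pow_ne_zero k n)

/-- `A_n` is finite-dimensional over `k` (basis `1, t, …, tⁿ`). [cite: FantechiManetti1999T1Lifting, Def. 1.1] -/
instance (n : ℕ) : Module.Finite k (A k n) :=
  (AdjoinRoot.powerBasis (pow_ne_zero (n + 1) (X_ne_zero (R := k)))).finite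

/-- `A_n` is Artinian. [cite: FantechiManetti1999T1Lifting, Def. 1.1] -/
instance (n : ℕ) : IsArtinianRing (A k n) := IsArtinianRing.of_finite k _

/-- The augmentation `A_n → k`, `t ↦ 0` (residue field `k`). [cite: FantechiManetti1999T1Lifting, Def. 1.1] -/
def augA (n : ℕ) : A k n →ₐ[k] k :=
  AdjoinRoot.liftAlgHom _ (Algebra.ofId k k) 0 (by simp)

/-- `augA (t) = 0`. [cite: FantechiManetti1999T1Lifting, Def. 1.1] -/
@[simp] theorem augA_t (n : ℕ) : augA k n (t k n) = 0 :=
  AdjoinRoot.liftAlgHom_root _ _ _ _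

/-- Every element of `A_n` is `c + t·b` with `c ∈ k`. [cite: FantechiManetti1999T1Lifting, Def. 1.1] -/
theorem exists_eq_algebraMap_add_t_mul (n : ℕ) (a : A k n) :
    ∃ (c : k) (b : A k n), a = algebraMap k _ c + t k n * b := by
  induction a using AdjoinRoot.induction_on with
  | ih p =>
    refine ⟨p.coeff 0, AdjoinRoot.mk _ p.divX, ?_⟩
    conv_lhs => rw [← X_mul_divX_add p]
    rw [map_add, map_mul, AdjoinRoot.mk_X, AdjoinRoot.mk_C, AdjoinRoot.algebraMap_eq, add_comm]

/-- `t·b` is nilpotent in `A_n`. [cite: FantechiManetti1999T1Lifting, Def. 1.1] -/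
theorem isNilpotent_t_mul (n : ℕ) (b : A k n) : IsNilpotent (t k n * b) :=
  ⟨n + 1, by rw [mul_pow, t_pow_succ, zero_mul]⟩

/-- `A_n` is local (an element is a unit iff its constant term is nonzero). [cite: FantechiManetti1999T1Lifting, Def. 1.1] -/
instance (n : ℕ) : IsLocalRing (A k n) :=
  .of_isUnit_or_isUnit_one_sub_self fun a => by
    obtain ⟨c, b, rfl⟩ := exists_eq_algebraMap_add_t_mul k n a
    by_cases hc : c = 0
    · refine Or.inr ?_
      rw [hc, map_zero, zero_add, sub_eq_add_neg]
      exact (isNilpotent_t_mul k n b).neg.isUnit_one_add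
    · exact Or.inl ((isNilpotent_t_mul k n b).isUnit_add_left_of_commute
        ((Ne.isUnit hc).map (algebraMap k (A k n))) (Commute.all _ _))

/-- Non-units of `A_n` are multiples of `t`. [cite: FantechiManetti1999T1Lifting, Def. 1.1] -/
theorem exists_eq_t_mul_of_not_isUnit (n : ℕ) {a : A k n} (ha : ¬IsUnit a) : ∃ b, a = t k n * b := by
  obtain ⟨c, b, rfl⟩ := exists_eq_algebraMap_add_t_mul k n a
  by_cases hc : c = 0
  · exact ⟨b, by rw [hc, map_zero, zero_add]⟩
  · exact absurd ((isNilpotent_t_mul k n b).isUnit_add_left_of_commute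
      ((Ne.isUnit hc).map (algebraMap k (A k n))) (Commute.all _ _)) ha

/-- The socle of `A_n` is `k·tⁿ`: `z · tⁿ = z(0) · tⁿ`. [cite: FantechiManetti1999T1Lifting, Def. 1.1] -/
theorem mul_t_pow (n : ℕ) (z : A k n) : z * t k n ^ n = augA k n z • t k n ^ n := by
  obtain ⟨c, b, rfl⟩ := exists_eq_algebraMap_add_t_mul k n z
  have h0 : t k n * b * t k n ^ n = 0 := by
    rw [mul_comm (t k n) b, mul_assoc, ← pow_succ', t_pow_succ, mul_zero]
  rw [add_mul, h0, add_zero, map_add, map_mul, augA_t, zero_mul, add_zero, AlgHom.commutes,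
    Algebra.algebraMap_self, RingHom.id_apply, Algebra.smul_def]

/-! ### `B_n = A_n[ε] = k[x,y]/(x^{n+1}, y²)` and `C_n = k[x,y]/(x^{n+1}, xⁿy, y²)` -/

/-- `B_n = k[x, y]/(x^{n+1}, y²)`, modelled as the dual numbers over `A_n` (`x = inl t`, `y = ε`).
[cite: FantechiManetti1999T1Lifting, Def. 1.1] -/
abbrev B (n : ℕ) : Type u := DualNumber (A k n)

/-- `B_n` is finite-dimensional over `k`. [cite: FantechiManetti1999T1Lifting, Def. 1.1] -/
instance (n : ℕ) : Module.Finite k (B k n) := inferInstanceAs (Module.Finite k (A k n × A k n))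

/-- `B_n` is Artinian. [cite: FantechiManetti1999T1Lifting, Def. 1.1] -/
instance (n : ℕ) : IsArtinianRing (B k n) := IsArtinianRing.of_finite k _

/-- `B_n ≠ 0`. [cite: FantechiManetti1999T1Lifting, Def. 1.1] -/
instance (n : ℕ) : Nontrivial (B k n) := inferInstanceAs (Nontrivial (A k n × A k n))

/-- `B_n = A_n[ε]` is local (units are detected on the `A_n`-component). [cite: FantechiManetti1999T1Lifting, Def. 1.1] -/
instance (n : ℕ) : IsLocalRing (B k n) :=
  .of_isUnit_or_isUnit_one_sub_self fun z => by
    rcases IsLocalRing.isUnit_or_isUnit_one_sub_self z.fst with h | h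
    · exact Or.inl (isUnit_iff_isUnit_fst.2 h)
    · exact Or.inr (isUnit_iff_isUnit_fst.2 (by simpa using h))

/-- The augmentation `B_n → k`, `x, y ↦ 0`. [cite: FantechiManetti1999T1Lifting, Def. 1.1] -/
def augB (n : ℕ) : B k n →ₐ[k] k := (augA k n).comp (fstHom k (A k n) (A k n))

/-- The element `xⁿy ∈ B_n`. [cite: FantechiManetti1999T1Lifting, p. 3] -/
def xny (n : ℕ) : B k n := inr (t k n ^ n)

/-- `xⁿy` has no `x`-component. [cite: FantechiManetti1999T1Lifting, p. 3] -/
@[simp] theorem fst_xny (n : ℕ) : (xny k n).fst = 0 := fst_inr _ _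

/-- The `y`-component of `xⁿy` is `tⁿ`. [cite: FantechiManetti1999T1Lifting, p. 3] -/
@[simp] theorem snd_xny (n : ℕ) : (xny k n).snd = t k n ^ n := snd_inr _ _

/-- `xⁿy ≠ 0` in `B_n`. [cite: FantechiManetti1999T1Lifting, p. 3] -/
theorem xny_ne_zero (n : ℕ) : xny k n ≠ 0 := fun h =>
  t_pow_ne_zero k n (by simpa using congrArg snd h)

/-- `xⁿy` is not a unit of `B_n`. [cite: FantechiManetti1999T1Lifting, p. 3] -/
theorem not_isUnit_xny (n : ℕ) : ¬IsUnit (xny k n) := by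
  rw [isUnit_iff_isUnit_fst, fst_xny]
  exact not_isUnit_zero

/-- In `B_n = A_n[ε]`: `w · inr v = inr (w.fst · v)`. [folklore] -/
private theorem mul_inr_eq (n : ℕ) (w : B k n) (v : A k n) : w * inr v = inr (w.fst * v) := by
  ext <;> simp [mul_comm]

/-- In `B_n = A_n[ε]`: `inr v · w = inr (v · w.fst)`. [folklore] -/
private theorem inr_mul_eq (n : ℕ) (w : B k n) (v : A k n) : inr v * w = inr (v * w.fst) := by
  ext <;> simp [mul_comm]

/-- The ideal `(xⁿy) ⊂ B_n`. [cite: FantechiManetti1999T1Lifting, p. 3] -/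
def cIdeal (n : ℕ) : Ideal (B k n) := Ideal.span {xny k n}

/-- Elements of `(xⁿy)` are the SCALAR multiples `c · xⁿy`, `c ∈ k`. [cite: FantechiManetti1999T1Lifting, p. 3] -/
theorem exists_eq_smul_xny_of_mem (n : ℕ) {z : B k n} (hz : z ∈ cIdeal k n) :
    ∃ c : k, z = c • xny k n := by
  obtain ⟨w, rfl⟩ := Ideal.mem_span_singleton'.1 hz
  refine ⟨augA k n w.fst, ?_⟩
  rw [xny, mul_inr_eq, mul_t_pow, inr_smul]

/-- `(xⁿy)` is a proper ideal. [cite: FantechiManetti1999T1Lifting, p. 3] -/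
theorem cIdeal_ne_top (n : ℕ) : cIdeal k n ≠ ⊤ := Ideal.span_singleton_ne_top (not_isUnit_xny k n)

/-- `C_n = k[x, y]/(x^{n+1}, xⁿy, y²) = B_n/(xⁿy)`. [cite: FantechiManetti1999T1Lifting, p. 3] -/
abbrev C (n : ℕ) : Type u := B k n ⧸ cIdeal k n

/-- `C_n ≠ 0`. [cite: FantechiManetti1999T1Lifting, p. 3] -/
instance (n : ℕ) : Nontrivial (C k n) := Ideal.Quotient.nontrivial_iff.2 (cIdeal_ne_top k n)

/-- `C_n` is local (a quotient of the local ring `B_n`). [cite: FantechiManetti1999T1Lifting, p. 3] -/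
instance (n : ℕ) : IsLocalRing (C k n) :=
  .of_surjective' (Ideal.Quotient.mk (cIdeal k n)) Ideal.Quotient.mk_surjective

/-- `C_n` is finite-dimensional over `k`. [cite: FantechiManetti1999T1Lifting, p. 3] -/
instance (n : ℕ) : Module.Finite k (C k n) :=
  Module.Finite.of_surjective (Ideal.Quotient.mkₐ k (cIdeal k n)).toLinearMap
    (Ideal.Quotient.mkₐ_surjective k _)

/-- `C_n` is Artinian. [cite: FantechiManetti1999T1Lifting, p. 3] -/
instance (n : ℕ) : IsArtinianRing (C k n) := IsArtinianRing.of_finite k _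

/-- The augmentation `C_n → k`. [cite: FantechiManetti1999T1Lifting, p. 3] -/
def augC (n : ℕ) : C k n →ₐ[k] k :=
  Ideal.Quotient.liftₐ (cIdeal k n) (augB k n) (by
    intro a ha
    obtain ⟨w, rfl⟩ := Ideal.mem_span_singleton'.1 ha
    simp [augB, xny])

/-! ### The maps `i`, `j`, `fB`, `fC` -/

/-- `i : A_{n+1} → A_n`, `t ↦ t`. [cite: FantechiManetti1999T1Lifting, Def. 1.1] -/
def i (n : ℕ) : A k (n + 1) →ₐ[k] A k n :=
  AdjoinRoot.liftAlgHom _ (Algebra.ofId k _) (t k n) (by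
    rw [eval₂_X_pow]
    exact t_pow_eq_zero_of_lt k (by omega))

/-- `i(t) = t`. [cite: FantechiManetti1999T1Lifting, Def. 1.1] -/
@[simp] theorem i_t (n : ℕ) : i k n (t k (n + 1)) = t k n := AdjoinRoot.liftAlgHom_root _ _ _ _

/-- `i(p(t)) = p(t)`: `i` is reduction modulo `t^{n+1}`. [cite: FantechiManetti1999T1Lifting, Def. 1.1] -/
theorem i_mk (n : ℕ) (p : k[X]) : i k n (AdjoinRoot.mk _ p) = AdjoinRoot.mk _ p := by
  rw [i, AdjoinRoot.liftAlgHom_mk, ← AdjoinRoot.aeval_eq]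
  rfl

/-- `j : B_n → C_n`, the quotient map by `(xⁿy)`. [cite: FantechiManetti1999T1Lifting, p. 3] -/
def j (n : ℕ) : B k n →ₐ[k] C k n := Ideal.Quotient.mkₐ k (cIdeal k n)

/-- `j` is surjective. [cite: FantechiManetti1999T1Lifting, p. 3] -/
theorem j_surjective (n : ℕ) : Function.Surjective (j k n) := Ideal.Quotient.mkₐ_surjective k _

/-- `ker j = (xⁿy)`. [cite: FantechiManetti1999T1Lifting, p. 3] -/
theorem j_eq_zero_iff (n : ℕ) (z : B k n) : j k n z = 0 ↔ z ∈ cIdeal k n :=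
  Ideal.Quotient.eq_zero_iff_mem

/-- `j(xⁿy) = 0`. [cite: FantechiManetti1999T1Lifting, p. 3] -/
@[simp] theorem j_xny (n : ℕ) : j k n (xny k n) = 0 :=
  (j_eq_zero_iff k n _).2 (Ideal.subset_span rfl)

/-- The element `x + y = inl t + ε ∈ B_m` (the image of `t` under Fantechi–Manetti's `f`).
[cite: FantechiManetti1999T1Lifting, p. 3] -/
def xy (m : ℕ) : B k m := inl (t k m) + ε

/-- The `x`-component of `x + y` is `t`. [cite: FantechiManetti1999T1Lifting, p. 3] -/
@[simp] theorem fst_xy (m : ℕ) : (xy k m).fst = t k m := by simp [xy]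

/-- The `y`-component of `x + y` is `1`. [cite: FantechiManetti1999T1Lifting, p. 3] -/
@[simp] theorem snd_xy (m : ℕ) : (xy k m).snd = 1 := by simp [xy]

/-- `(x + y)^N` has `x`-component `x^N`. [cite: FantechiManetti1999T1Lifting, p. 3] -/
@[simp] theorem fst_xy_pow (m N : ℕ) : (xy k m ^ N).fst = t k m ^ N := by
  rw [fst_pow, fst_xy]

/-- `(x + y)^N` has `y`-component `N x^{N-1}` (binomial formula, `y² = 0`).
[cite: FantechiManetti1999T1Lifting, p. 3] -/
@[simp] theorem snd_xy_pow (m N : ℕ) : (xy k m ^ N).snd = N • t k m ^ (N - 1) := by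
  rw [snd_pow, fst_xy, snd_xy, smul_eq_mul, mul_one, Nat.pred_eq_sub_one]

/-- `(x + y)^{m+1} = (m+1) · xᵐy` in `B_m` (binomial formula with `y² = 0`, `x^{m+1} = 0`).
[cite: FantechiManetti1999T1Lifting, p. 3] -/
theorem xy_pow_succ (m : ℕ) : xy k m ^ (m + 1) = ((m + 1 : ℕ) : k) • xny k m := by
  ext
  · simp [t_pow_succ]
  · simp only [snd_xy_pow, Nat.add_sub_cancel, snd_smul, snd_xny, Nat.cast_smul_eq_nsmul]

/-- `(x + y)^{m+2} = 0` in `B_m`. [cite: FantechiManetti1999T1Lifting, p. 3] -/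
theorem xy_pow_succ_succ (m : ℕ) : xy k m ^ (m + 2) = 0 := by
  ext
  · simp [t_pow_eq_zero_of_lt k (show m < m + 2 by omega)]
  · simp [t_pow_succ]

/-- `fB : A_{m+1} → B_m`, `t ↦ x + y` — the `t`-component of Fantechi–Manetti's `f(t, s) = (x + y, xᵐ)` on
`A = k[t, s]`; the quotient `A_{m+1} = k[t]/(t^{m+2})` sees only `t` (the `s`-slot serves the algebras `V_n`, `A′_n` of
the general case, pp. 3–4). [cite: FantechiManetti1999T1Lifting, p. 3] -/
def fB (m : ℕ) : A k (m + 1) →ₐ[k] B k m :=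
  AdjoinRoot.liftAlgHom _ (Algebra.ofId k _) (xy k m) (by rw [eval₂_X_pow]; exact xy_pow_succ_succ k m)

/-- `fB(t) = x + y`. [cite: FantechiManetti1999T1Lifting, p. 3] -/
@[simp] theorem fB_t (m : ℕ) : fB k m (t k (m + 1)) = xy k m := AdjoinRoot.liftAlgHom_root _ _ _ _

/-- `fC : A_m → C_m`, `t ↦ x + y` (the `t`-component of Fantechi–Manetti's `f` on `A_m`).
[cite: FantechiManetti1999T1Lifting, p. 3] -/
def fC (m : ℕ) : A k m →ₐ[k] C k m :=
  AdjoinRoot.liftAlgHom _ (Algebra.ofId k _) (j k m (xy k m)) (by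
    rw [eval₂_X_pow, ← map_pow, j_eq_zero_iff, xy_pow_succ]
    exact Submodule.smul_of_tower_mem _ _ (Ideal.subset_span rfl))

/-- `fC(t) = x + y (mod xᵐy)`. [cite: FantechiManetti1999T1Lifting, p. 3] -/
@[simp] theorem fC_t (m : ℕ) : fC k m (t k m) = j k m (xy k m) := AdjoinRoot.liftAlgHom_root _ _ _ _

/-- The square commutes: `j ∘ fB = fC ∘ i : A_{m+1} → C_m`. [cite: FantechiManetti1999T1Lifting, p. 3] -/
theorem j_comp_fB (m : ℕ) : (j k m).comp (fB k m) = (fC k m).comp (i k m) :=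
  AdjoinRoot.algHom_ext (by simp)

/-- Kernel of `i : A_{m+1} → A_m` is `k · t^{m+1}`. [cite: FantechiManetti1999T1Lifting, Def. 1.1] -/
theorem exists_eq_smul_of_i_eq_zero (m : ℕ) {e : A k (m + 1)} (he : i k m e = 0) :
    ∃ c : k, e = c • t k (m + 1) ^ (m + 1) := by
  induction e using AdjoinRoot.induction_on with
  | ih p =>
    rw [i_mk, AdjoinRoot.mk_eq_zero] at he
    obtain ⟨q, rfl⟩ := he
    obtain ⟨c, b, hq⟩ := exists_eq_algebraMap_add_t_mul k (m + 1) (AdjoinRoot.mk _ q)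
    refine ⟨c, ?_⟩
    have ht : AdjoinRoot.mk ((X : k[X]) ^ (m + 1 + 1)) (X ^ (m + 1)) = t k (m + 1) ^ (m + 1) := by
      rw [map_pow, AdjoinRoot.mk_X]
    rw [map_mul, hq, ht, mul_add, Algebra.smul_def, mul_comm _ (algebraMap k _ c), ← mul_assoc,
      ← pow_succ, t_pow_succ, zero_mul, add_zero]

/-- `i : A_{n+1} → A_n` is surjective. [cite: FantechiManetti1999T1Lifting, Def. 1.1] -/
theorem i_surjective (n : ℕ) : Function.Surjective (i k n) := fun a => by
  obtain ⟨p, rfl⟩ := AdjoinRoot.mk_surjective a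
  exact ⟨AdjoinRoot.mk _ p, i_mk k n p⟩

/-! ### The maps of Definition 1.1: `B_n → A_n` (`x ↦ t, y ↦ 0`) and `B_{n+1} → B_n` -/

/-- `bA : B_n → A_n`, `x ↦ t, y ↦ 0` («let `B_n → A_n` be the map defined by `x ↦ t, y ↦ 0`»).
[cite: FantechiManetti1999T1Lifting, Def. 1.1] -/
def bA (n : ℕ) : B k n →ₐ[k] A k n := fstHom k (A k n) (A k n)

/-- `bA` is the first projection of `A_n[ε]`. [cite: FantechiManetti1999T1Lifting, Def. 1.1] -/
@[simp] theorem bA_apply (n : ℕ) (z : B k n) : bA k n z = z.fst := rfl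

/-- `β : B_{n+1} → B_n`, `x ↦ x, y ↦ y` (the natural map of Def. 1.1). [cite: FantechiManetti1999T1Lifting, Def. 1.1] -/
def β (n : ℕ) : B k (n + 1) →ₐ[k] B k n :=
  DualNumber.lift (R := k) (A := A k (n + 1)) (B := B k n)
    ⟨((inlAlgHom k (A k n) (A k n)).comp (i k n), ε), eps_mul_eps, fun _ => Commute.all _ _⟩

/-- `β` acts by `i` on the `x`-component. [cite: FantechiManetti1999T1Lifting, Def. 1.1] -/
@[simp] theorem fst_β (n : ℕ) (z : B k (n + 1)) : (β k n z).fst = i k n z.fst := by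
  simp [β, DualNumber.lift_apply_apply]

/-- `β` acts by `i` on the `y`-component. [cite: FantechiManetti1999T1Lifting, Def. 1.1] -/
@[simp] theorem snd_β (n : ℕ) (z : B k (n + 1)) : (β k n z).snd = i k n z.snd := by
  simp [β, DualNumber.lift_apply_apply]

/-- `β(x^{n+1}y) = 0`. [cite: FantechiManetti1999T1Lifting, p. 3] -/
theorem β_xny (n : ℕ) : β k n (xny k (n + 1)) = 0 := by
  ext
  · simp
  · rw [snd_β, snd_xny, map_pow, i_t, t_pow_succ, snd_zero]

/-! ### The square `C_{n+1} → A_{n+1}`, `C_{n+1} → B_n` over `A_n` (p. 3, l. 13–19) -/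

/-- `gC : C_{n+1} → A_{n+1}`, `x ↦ t, y ↦ 0` (Fantechi–Manetti's `g(x, y) = (t, 0)`).
[cite: FantechiManetti1999T1Lifting, p. 3] -/
def gC (n : ℕ) : C k (n + 1) →ₐ[k] A k (n + 1) :=
  Ideal.Quotient.liftₐ (cIdeal k (n + 1)) (bA k (n + 1)) (by
    intro a ha
    obtain ⟨w, rfl⟩ := Ideal.mem_span_singleton'.1 ha
    simp [xny])

/-- `jB : C_{n+1} → B_n`, `x ↦ x, y ↦ y` (the map denoted `j` on p. 3). [cite: FantechiManetti1999T1Lifting, p. 3] -/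
def jB (n : ℕ) : C k (n + 1) →ₐ[k] B k n :=
  Ideal.Quotient.liftₐ (cIdeal k (n + 1)) (β k n) (by
    intro a ha
    obtain ⟨w, rfl⟩ := Ideal.mem_span_singleton'.1 ha
    rw [map_mul, β_xny, mul_zero])

/-- `gC ∘ j = bA`. [cite: FantechiManetti1999T1Lifting, p. 3] -/
@[simp] theorem gC_comp_j (n : ℕ) : (gC k n).comp (j k (n + 1)) = bA k (n + 1) :=
  Ideal.Quotient.liftₐ_comp _ _ _

/-- `jB ∘ j = β`. [cite: FantechiManetti1999T1Lifting, p. 3] -/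
@[simp] theorem jB_comp_j (n : ℕ) : (jB k n).comp (j k (n + 1)) = β k n :=
  Ideal.Quotient.liftₐ_comp _ _ _

/-- The square commutes: `i ∘ gC = bA ∘ jB : C_{n+1} → A_n`. [cite: FantechiManetti1999T1Lifting, p. 3] -/
theorem i_comp_gC (n : ℕ) : (i k n).comp (gC k n) = (bA k n).comp (jB k n) := by
  refine Ideal.Quotient.algHom_ext (R₁ := k) (I := cIdeal k (n + 1)) ?_
  show ((i k n).comp (gC k n)).comp (j k (n + 1)) = ((bA k n).comp (jB k n)).comp (j k (n + 1))
  rw [AlgHom.comp_assoc, AlgHom.comp_assoc, gC_comp_j, jB_comp_j]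
  exact AlgHom.ext fun z => by simp

end T1Lifting

open T1Lifting

/-! ### Cartesian squares and small extensions of `k`-algebras -/

section Squares

variable (k : Type u) [Field k]
variable {R₀ R₁ R₂ R₃ : Type u} [CommRing R₀] [Algebra k R₀] [CommRing R₁] [Algebra k R₁]
  [CommRing R₂] [Algebra k R₂] [CommRing R₃] [Algebra k R₃]

/-- A commutative square of `k`-algebras
```
R₃ --q'--> R₁
|p'        |p
v          v
R₂ --q---> R₀
```
is CARTESIAN: `R₃` maps isomorphically onto the fibre product `R₁ ×_{R₀} R₂` (pairs with the same image in `R₀`),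
i.e. `(q', p')` is jointly injective and every compatible pair lifts — `R₃` is a fibre product `R₁ ×_{R₀} R₂`,
Schlessinger's ring «`A ×_B C` … consisting of all pairs `(a, c)` with `a ∈ A`, `c ∈ C`, for which `pa = qc`»
(§1, p. 209), the source of the comparison map (2.12) `F(A' ×_A A'') → F(A') ×_{F(A)} F(A'')` of Thm. 2.11 (p. 212);
any model of the fibre product is allowed here. [cite: Schlessinger1968, §1 p. 209 and Thm. 2.11 (2.12)] -/
structure IsCartesian (p : R₁ →ₐ[k] R₀) (q : R₂ →ₐ[k] R₀) (q' : R₃ →ₐ[k] R₁) (p' : R₃ →ₐ[k] R₂) : Prop where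
  comm : p.comp q' = q.comp p'
  exists_lift : ∀ (b : R₁) (a : R₂), p b = q a → ∃ d : R₃, q' d = b ∧ p' d = a
  lift_unique : ∀ d d' : R₃, q' d = q' d' → p' d = p' d' → d = d'

/-- A SMALL EXTENSION: «`p` is a small extension if kernel `p` is a nonzero principal ideal `(t)` such that
`𝔪 t = (0)`, where `𝔪` is the maximal ideal» of the source, `p` a surjection (Schlessinger, Def. 1.2; in
[FantechiManetti1999T1Lifting, §0, p. 2] the kernel may be any `k`-vector space — Schlessinger's is the case
`dim M = 1`, and (H1) for these implies (H1) for all surjections, [Schlessinger1968, Remark (2.14)]).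
[cite: Schlessinger1968, Def. 1.2] -/
structure IsSmallExtension [IsLocalRing R₁] (p : R₁ →ₐ[k] R₀) : Prop where
  surjective : Function.Surjective p
  ker_mul_maximalIdeal : RingHom.ker p * IsLocalRing.maximalIdeal R₁ = ⊥
  exists_ker_eq_span : ∃ x : R₁, x ≠ 0 ∧ RingHom.ker p = Ideal.span {x}

end Squares

namespace T1Lifting

variable (k : Type u) [Field k]

/-- `j : B_m → C_m` is a small extension with kernel `(xᵐy) ≅ k`. [cite: FantechiManetti1999T1Lifting, p. 3] -/
theorem isSmallExtension_j (m : ℕ) : IsSmallExtension k (R₁ := B k m) (R₀ := C k m) (j k m) where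
  surjective := j_surjective k m
  ker_mul_maximalIdeal := by
    rw [eq_bot_iff, Ideal.mul_le]
    intro r hr s hs
    rw [RingHom.mem_ker] at hr
    obtain ⟨c, rfl⟩ := exists_eq_smul_xny_of_mem k m ((j_eq_zero_iff k m _).1 hr)
    have hs' : ¬IsUnit s.fst := fun h => (IsLocalRing.mem_maximalIdeal _).1 hs (isUnit_iff_isUnit_fst.2 h)
    obtain ⟨b, hb⟩ := exists_eq_t_mul_of_not_isUnit k m hs'
    rw [Ideal.mem_bot, smul_mul_assoc, xny, inr_mul_eq, hb, ← mul_assoc, ← pow_succ, t_pow_succ, zero_mul,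
      inr_zero, smul_zero]
  exists_ker_eq_span := ⟨xny k m, xny_ne_zero k m, by rw [j]; exact Ideal.Quotient.mkₐ_ker k _⟩

/-- **The cartesian diagram of [FantechiManetti1999T1Lifting, p. 3, l. 21–23] (characteristic zero):**
`A_{m+1} ≅ B_m ×_{C_m} A_m` via `(fB, i)` over `(j, fC)`. The lift of a compatible pair `(b, a)` is
`p(t) + (c/(m+1)) t^{m+1}` where `a = p(t)` and `b - p(x+y) = c · xᵐy`; this uses `(x+y)^{m+1} = (m+1) xᵐy` and
`m + 1 ≠ 0` in `k`. [cite: FantechiManetti1999T1Lifting, p. 3] -/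
theorem isCartesian_fB_i [CharZero k] (m : ℕ) :
    IsCartesian k (R₀ := C k m) (R₁ := B k m) (R₂ := A k m) (R₃ := A k (m + 1))
      (j k m) (fC k m) (fB k m) (i k m) where
  comm := j_comp_fB k m
  exists_lift := by
    intro b a hab
    obtain ⟨p, rfl⟩ := AdjoinRoot.mk_surjective a
    -- the naive lift `p(t) ∈ A_{m+1}` has the right image in `A_m`; its image in `B_m` differs from `b` by an
    -- element of `ker j = k · xᵐy`
    set d₀ : A k (m + 1) := AdjoinRoot.mk _ p with hd₀
    have hi : i k m d₀ = AdjoinRoot.mk _ p := i_mk k m p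
    have hj : j k m (b - fB k m d₀) = 0 := by
      rw [map_sub, sub_eq_zero, hab, ← hi]
      exact (AlgHom.congr_fun (j_comp_fB k m) d₀).symm
    obtain ⟨c, hc⟩ := exists_eq_smul_xny_of_mem k m ((j_eq_zero_iff k m _).1 hj)
    have hm : ((m + 1 : ℕ) : k) ≠ 0 := Nat.cast_ne_zero.2 (Nat.succ_ne_zero m)
    refine ⟨d₀ + (c / ((m + 1 : ℕ) : k)) • t k (m + 1) ^ (m + 1), ?_, ?_⟩
    · rw [map_add, map_smul, map_pow, fB_t, xy_pow_succ, smul_smul, div_mul_cancel₀ _ hm, ← hc,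
        add_sub_cancel]
    · rw [map_add, map_smul, map_pow, i_t, t_pow_succ, smul_zero, add_zero, hi]
  lift_unique := by
    intro d d' hB hA
    rw [← sub_eq_zero] at hB hA ⊢
    rw [← map_sub] at hB hA
    obtain ⟨c, hc⟩ := exists_eq_smul_of_i_eq_zero k m hA
    rw [hc, map_smul, map_pow, fB_t, xy_pow_succ, smul_smul] at hB
    have h2 := congrArg snd hB
    rw [snd_smul, snd_xny, snd_zero, smul_eq_zero] at h2
    rcases h2 with h2 | h2
    · rcases mul_eq_zero.1 h2 with h3 | h3
      · rw [hc, h3, zero_smul]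
      · exact absurd h3 (Nat.cast_ne_zero.2 (Nat.succ_ne_zero m))
    · exact absurd h2 (t_pow_ne_zero k m)

/-- `i : A_{n+1} → A_n` is a small extension with kernel `(t^{n+1}) ≅ k` (a curvilinear small extension).
[cite: FantechiManetti1999T1Lifting, Def. 1.1] -/
theorem isSmallExtension_i (n : ℕ) : IsSmallExtension k (R₁ := A k (n + 1)) (R₀ := A k n) (i k n) where
  surjective := i_surjective k n
  ker_mul_maximalIdeal := by
    rw [eq_bot_iff, Ideal.mul_le]
    intro r hr s hs
    obtain ⟨c, rfl⟩ := exists_eq_smul_of_i_eq_zero k n ((RingHom.mem_ker).1 hr)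
    have hs' : ¬IsUnit s := fun h => (IsLocalRing.mem_maximalIdeal _).1 hs h
    obtain ⟨b, rfl⟩ := exists_eq_t_mul_of_not_isUnit k (n + 1) hs'
    rw [Ideal.mem_bot, smul_mul_assoc, ← mul_assoc, ← pow_succ, t_pow_succ, zero_mul, smul_zero]
  exists_ker_eq_span := by
    refine ⟨t k (n + 1) ^ (n + 1), t_pow_ne_zero k (n + 1), le_antisymm ?_ ?_⟩
    · intro e he
      obtain ⟨c, rfl⟩ := exists_eq_smul_of_i_eq_zero k n ((RingHom.mem_ker).1 he)
      exact Submodule.smul_of_tower_mem _ c (Ideal.subset_span rfl)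
    · rw [Ideal.span_le, Set.singleton_subset_iff, SetLike.mem_coe, RingHom.mem_ker]
      exact show i k n (t k (n + 1) ^ (n + 1)) = 0 by rw [map_pow, i_t, t_pow_succ]

/-- **The cartesian diagram of [FantechiManetti1999T1Lifting, p. 3, l. 13–19] (any characteristic):**
`C_{n+1} ≅ B_n ×_{A_n} A_{n+1}` via `(gC, jB)` over `(i, bA)` — «in particular the T¹-lifting condition can be
rephrased by saying that, given a `c ∈ F(C_n)`, there exists `b ∈ F(B_n)` having the same projections to `B_{n-1}`
and `A_n`». [cite: FantechiManetti1999T1Lifting, p. 3] -/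
theorem isCartesian_gC_jB (n : ℕ) :
    IsCartesian k (R₀ := A k n) (R₁ := A k (n + 1)) (R₂ := B k n) (R₃ := C k (n + 1))
      (i k n) (bA k n) (gC k n) (jB k n) where
  comm := i_comp_gC k n
  exists_lift := by
    intro a b hab
    obtain ⟨s, hs⟩ := i_surjective k n b.snd
    refine ⟨j k (n + 1) (inl a + inr s), ?_, ?_⟩
    · rw [← AlgHom.comp_apply, gC_comp_j, bA_apply, fst_add, fst_inl, fst_inr, add_zero]
    · rw [← AlgHom.comp_apply, jB_comp_j]
      ext
      · rw [fst_β, fst_add, fst_inl, fst_inr, add_zero, hab, bA_apply]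
      · rw [snd_β, snd_add, snd_inl, snd_inr, zero_add, hs]
  lift_unique := by
    intro d d' hA hB
    obtain ⟨z, rfl⟩ := j_surjective k (n + 1) d
    obtain ⟨z', rfl⟩ := j_surjective k (n + 1) d'
    rw [← AlgHom.comp_apply, ← AlgHom.comp_apply, gC_comp_j, bA_apply, bA_apply] at hA
    rw [← AlgHom.comp_apply, ← AlgHom.comp_apply, jB_comp_j] at hB
    have h2 : i k n (z.snd - z'.snd) = 0 := by
      rw [map_sub, sub_eq_zero, ← snd_β, ← snd_β, hB]
    obtain ⟨c, hc⟩ := exists_eq_smul_of_i_eq_zero k n h2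
    rw [j, Ideal.Quotient.mkₐ_eq_mk, Ideal.Quotient.eq]
    have hz : z - z' = c • xny k (n + 1) := by
      ext
      · rw [fst_sub, hA, sub_self, fst_smul, fst_xny, smul_zero]
      · rw [snd_sub, hc, snd_smul, snd_xny]
    rw [hz]
    exact Submodule.smul_of_tower_mem _ c (Ideal.subset_span rfl)

end T1Lifting

/-! ### Functors of Artin rings, (H1), the T¹-lifting property under (H4), and Kawamata's theorem -/

section Functors

variable (k : Type u) [Field k]

/-- An object of `Art_k` («Artinian local algebras over `k` with residue field `k`», [FantechiManetti1999T1Lifting,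
p. 1]; Schlessinger's category `C`, [Schlessinger1968, §1]): a local Artinian `k`-algebra with residue field `k`,
the last condition recorded as the existence of a `k`-algebra augmentation `R → k` (its kernel is then the maximal
ideal, and `k`-algebra maps between such algebras are automatically local).
[cite: FantechiManetti1999T1Lifting, p. 1] -/
structure ArtAlg : Type (u + 1) where
  /-- the underlying type -/
  carrier : Type u
  [commRing : CommRing carrier]
  [algebra : Algebra k carrier]
  [isArtinianRing : IsArtinianRing carrier]
  [isLocalRing : IsLocalRing carrier]
  /-- the residue field is `k` -/
  exists_augmentation : Nonempty (carrier →ₐ[k] k)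

attribute [instance] ArtAlg.commRing ArtAlg.algebra ArtAlg.isArtinianRing ArtAlg.isLocalRing

/-- An object of `Art_k` coerces to its underlying type. [folklore] -/
instance : CoeSort (ArtAlg.{u} k) (Type u) := ⟨ArtAlg.carrier⟩

namespace T1Lifting

/-- `A_n` as an object of `Art_k`. [cite: FantechiManetti1999T1Lifting, Def. 1.1] -/
abbrev artA (n : ℕ) : ArtAlg.{u} k := { carrier := A k n, exists_augmentation := ⟨augA k n⟩ }

/-- `B_n` as an object of `Art_k`. [cite: FantechiManetti1999T1Lifting, Def. 1.1] -/
abbrev artB (n : ℕ) : ArtAlg.{u} k := { carrier := B k n, exists_augmentation := ⟨augB k n⟩ }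

/-- `C_n` as an object of `Art_k`. [cite: FantechiManetti1999T1Lifting, p. 3] -/
abbrev artC (n : ℕ) : ArtAlg.{u} k := { carrier := C k n, exists_augmentation := ⟨augC k n⟩ }

end T1Lifting

/-- A FUNCTOR OF ARTIN RINGS: a covariant functor `F : Art_k → Sets` ([FantechiManetti1999T1Lifting, p. 1]:
«let `F : Art_k → Sets` be a covariant functor with `F(k) = {pt}`»; the normalisation `F(k) = {pt}` is not needed
below and not imposed). [cite: FantechiManetti1999T1Lifting, p. 1] -/
structure ArtinFunctor : Type (u + 1) where
  /-- the value on an object -/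
  obj : ArtAlg.{u} k → Type u
  /-- the value on a morphism (`k`-algebra homomorphism; between objects of `Art_k` these are automatically local) -/
  map : ∀ {R S : ArtAlg.{u} k}, (R →ₐ[k] S) → obj R → obj S
  map_id : ∀ {R : ArtAlg.{u} k} (x : obj R), map (AlgHom.id k R) x = x
  map_comp : ∀ {R S T : ArtAlg.{u} k} (φ : R →ₐ[k] S) (ψ : S →ₐ[k] T) (x : obj R),
    map (ψ.comp φ) x = map ψ (map φ x)

variable {k}

/-- SCHLESSINGER'S CONDITION (H₁): «`F(A' ×_A A'') → F(A') ×_{F(A)} F(A'')` is a surjection whenever `A'' → A`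
is a small extension» [Schlessinger1968, Thm. 2.11 (H₁)], stated for every cartesian square `R₃ = R₁ ×_{R₀} R₂` in
`Art_k` (any model of the fibre product) whose side `p : R₁ → R₀` is a small extension: every pair
`(y, z) ∈ F(R₁) × F(R₂)` with the same image in `F(R₀)` lifts to `F(R₃)`. [cite: Schlessinger1968, Thm. 2.11] -/
def ArtinFunctor.H1 (F : ArtinFunctor.{u} k) : Prop :=
  ∀ ⦃R₀ R₁ R₂ R₃ : ArtAlg.{u} k⦄ (p : R₁ →ₐ[k] R₀) (q : R₂ →ₐ[k] R₀) (q' : R₃ →ₐ[k] R₁) (p' : R₃ →ₐ[k] R₂),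
    IsCartesian k p q q' p' → IsSmallExtension k p →
    ∀ (y : F.obj R₁) (z : F.obj R₂), F.map p y = F.map q z → ∃ w : F.obj R₃, F.map q' w = y ∧ F.map p' w = z

/-- SCHLESSINGER'S CONDITION (H₄) in the square form of [FantechiManetti1998ObstructionCalculus, Def. 2.7]: «Map (∗)
[`F(A' ×_A A'') → F(A') ×_{F(A)} F(A'')`] is bijective if `A'' → A` is a principal small extension» — for every
cartesian square in `Art_k` whose side `p` is a small extension, compatible pairs lift (surjectivity) AND the pair
of maps `(F(q'), F(p'))` is jointly injective on `F(R₃)`. Pro-representable functors satisfy it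
([Schlessinger1968, Thm. 2.11 (2)]). [cite: FantechiManetti1998ObstructionCalculus, Def. 2.7] -/
def ArtinFunctor.H4 (F : ArtinFunctor.{u} k) : Prop :=
  ∀ ⦃R₀ R₁ R₂ R₃ : ArtAlg.{u} k⦄ (p : R₁ →ₐ[k] R₀) (q : R₂ →ₐ[k] R₀) (q' : R₃ →ₐ[k] R₁) (p' : R₃ →ₐ[k] R₂),
    IsCartesian k p q q' p' → IsSmallExtension k p →
    (∀ (y : F.obj R₁) (z : F.obj R₂), F.map p y = F.map q z → ∃ w : F.obj R₃, F.map q' w = y ∧ F.map p' w = z) ∧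
    (∀ w w' : F.obj R₃, F.map q' w = F.map q' w' → F.map p' w = F.map p' w' → w = w')

/-- (H₄) implies (H₁) (bijective ⇒ surjective). [cite: FantechiManetti1998ObstructionCalculus, Def. 2.7] -/
theorem ArtinFunctor.H4.h1 {F : ArtinFunctor.{u} k} (h : F.H4) : F.H1 :=
  fun _ _ _ _ p q q' p' hc hs => (h p q q' p' hc hs).1

/-- The FUNCTOR OF POINTS `h_R : X ↦ Hom_k(R, X)` of a commutative `k`-algebra `R`, as a functor of Artin rings
(Schlessinger's `h_R` when `R` is a complete local `k`-algebra; pro-representable functors are those isomorphic to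
some `h_R`). [cite: Schlessinger1968, §2] -/
def ArtinFunctor.points (R : Type u) [CommRing R] [Algebra k R] : ArtinFunctor.{u} k where
  obj X := R →ₐ[k] X
  map φ f := φ.comp f
  map_id _ := AlgHom.ext fun _ => rfl
  map_comp _ _ _ := AlgHom.ext fun _ => rfl

/-- «Notice that if `F` is isomorphic to some `h_R`, then (2.12) is an isomorphism for any morphisms `A' → A`,
`A'' → A`»: the functor of points of ANY commutative `k`-algebra `R` satisfies (H₄) in the square form — a cartesian
square of `k`-algebras is a fibre product, so compatible `R → R₁`, `R → R₂` factor uniquely through `R₃` (the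
set-theoretic lift is a `k`-algebra map by uniqueness of lifts). In particular the hypotheses (H₁)/(H₄) above are
inhabited. [cite: Schlessinger1968, Thm. 2.11] -/
theorem ArtinFunctor.points_H4 (R : Type u) [CommRing R] [Algebra k R] :
    (ArtinFunctor.points (k := k) R).H4 := by
  intro R₀ R₁ R₂ R₃ p q q' p' hc _hs
  refine ⟨fun (y : R →ₐ[k] R₁) (z : R →ₐ[k] R₂) hyz => ?_, fun (w w' : R →ₐ[k] R₃) hq hp => ?_⟩
  · have key : ∀ r, p (y r) = q (z r) := fun r => AlgHom.congr_fun hyz r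
    choose d hd using fun r => hc.exists_lift (y r) (z r) (key r)
    have uniq : ∀ r x, q' x = y r → p' x = z r → x = d r := fun r x hx1 hx2 =>
      hc.lift_unique x (d r) (hx1.trans (hd r).1.symm) (hx2.trans (hd r).2.symm)
    let D : R →ₐ[k] R₃ :=
      { toFun := d
        map_one' := (uniq 1 1 (by rw [map_one, map_one]) (by rw [map_one, map_one])).symm
        map_mul' := fun a b => (uniq (a * b) (d a * d b)
          (by rw [map_mul, (hd a).1, (hd b).1, map_mul]) (by rw [map_mul, (hd a).2, (hd b).2, map_mul])).symm
        map_zero' := (uniq 0 0 (by rw [map_zero, map_zero]) (by rw [map_zero, map_zero])).symm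
        map_add' := fun a b => (uniq (a + b) (d a + d b)
          (by rw [map_add, (hd a).1, (hd b).1, map_add]) (by rw [map_add, (hd a).2, (hd b).2, map_add])).symm
        commutes' := fun c => (uniq (algebraMap k R c) (algebraMap k R₃ c)
          (by rw [AlgHom.commutes, AlgHom.commutes]) (by rw [AlgHom.commutes, AlgHom.commutes])).symm }
    exact ⟨D, AlgHom.ext fun r => (hd r).1, AlgHom.ext fun r => (hd r).2⟩
  · exact AlgHom.ext fun r => hc.lift_unique (w r) (w' r) (AlgHom.congr_fun hq r) (AlgHom.congr_fun hp r)

/-- THE T¹-LIFTING PROPERTY [FantechiManetti1999T1Lifting, Def. 1.1] (= [FantechiManetti1998ObstructionCalculus,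
Def. 6.13]; after [Ran1992DeformationsNegativeCanonical], [Kawamata1992UnobstructedDeformations]): «A functor of
Artin rings `F` has the T¹-lifting property if, for every `n ∈ ℕ`, the natural map
`F(B_{n+1}) → F(B_n) ×_{F(A_n)} F(A_{n+1})` is surjective», the maps being induced by `β : B_{n+1} → B_n`,
`bA : B_n → A_n` (`x ↦ t, y ↦ 0`) and `i : A_{n+1} → A_n`. [cite: FantechiManetti1999T1Lifting, Def. 1.1] -/
def ArtinFunctor.T1Lifting (F : ArtinFunctor.{u} k) : Prop :=
  ∀ (n : ℕ) (b : F.obj (T1Lifting.artB k n)) (a : F.obj (T1Lifting.artA k (n + 1))),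
    F.map (R := T1Lifting.artB k n) (S := T1Lifting.artA k n) (T1Lifting.bA k n) b =
      F.map (R := T1Lifting.artA k (n + 1)) (S := T1Lifting.artA k n) (T1Lifting.i k n) a →
    ∃ b' : F.obj (T1Lifting.artB k (n + 1)),
      F.map (R := T1Lifting.artB k (n + 1)) (S := T1Lifting.artB k n) (T1Lifting.β k n) b' = b ∧
      F.map (R := T1Lifting.artB k (n + 1)) (S := T1Lifting.artA k (n + 1)) (T1Lifting.bA k (n + 1)) b' = a

/-- THE T¹-LIFTING PROPERTY IN THE FORM IT TAKES UNDER (H4): «If `F` satisfies (H4), then the T¹-lifting condition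
becomes that `F(B_n) → F(C_n)` is onto for every `n ∈ ℕ`» (the map induced by `j : B_n → C_n`). At `n = 0` this reads
«`F(k[ε]) → F(C_0) = F(k)` onto», automatic in print where `F(k) = {pt}`; the theorems below use it only for `n ≥ 1`
or derive it from Def. 1.1. [cite: FantechiManetti1999T1Lifting, p. 3] -/
def ArtinFunctor.T1LiftingH4 (F : ArtinFunctor.{u} k) : Prop :=
  ∀ n : ℕ, Function.Surjective (F.map (R := T1Lifting.artB k n) (S := T1Lifting.artC k n) (T1Lifting.j k n))

/-- Under (H4), the T¹-lifting property gives «`F(B_n) → F(C_n)` onto» for every `n ≥ 1`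
([FantechiManetti1999T1Lifting, p. 3, l. 13–21]: `C_n ≅ B_{n-1} ×_{A_{n-1}} A_n`, so a `c ∈ F(C_n)` has projections
`(b, a)` which lift to some `b' ∈ F(B_n)` by T¹-lifting, and `F(j)(b') = c` by the injectivity half of (H4) applied to
the same square, whose side `A_n → A_{n-1}` is a small extension). [cite: FantechiManetti1999T1Lifting, p. 3] -/
theorem ArtinFunctor.map_j_succ_surjective_of_t1Lifting (F : ArtinFunctor.{u} k) (h4 : F.H4)
    (hT : F.T1Lifting) (n : ℕ) :
    Function.Surjective
      (F.map (R := T1Lifting.artB k (n + 1)) (S := T1Lifting.artC k (n + 1)) (T1Lifting.j k (n + 1))) := by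
  intro c
  have hsq := h4 (R₀ := T1Lifting.artA k n) (R₁ := T1Lifting.artA k (n + 1)) (R₂ := T1Lifting.artB k n)
    (R₃ := T1Lifting.artC k (n + 1)) (T1Lifting.i k n) (T1Lifting.bA k n) (T1Lifting.gC k n) (T1Lifting.jB k n)
    (T1Lifting.isCartesian_gC_jB k n) (T1Lifting.isSmallExtension_i k n)
  -- the projections `(b, a)` of `c` to `B_n` and `A_{n+1}` agree in `A_n`
  have hcomp : F.map (R := T1Lifting.artB k n) (S := T1Lifting.artA k n) (T1Lifting.bA k n)
        (F.map (R := T1Lifting.artC k (n + 1)) (S := T1Lifting.artB k n) (T1Lifting.jB k n) c) =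
      F.map (R := T1Lifting.artA k (n + 1)) (S := T1Lifting.artA k n) (T1Lifting.i k n)
        (F.map (R := T1Lifting.artC k (n + 1)) (S := T1Lifting.artA k (n + 1)) (T1Lifting.gC k n) c) := by
    rw [← F.map_comp, ← F.map_comp]
    exact congrArg (fun φ => F.map (R := T1Lifting.artC k (n + 1)) (S := T1Lifting.artA k n) φ c)
      (T1Lifting.i_comp_gC k n).symm
  obtain ⟨b', hb'1, hb'2⟩ := hT n _ _ hcomp
  refine ⟨b', hsq.2 _ _ ?_ ?_⟩
  · rw [← F.map_comp]
    exact (congrArg (fun φ => F.map (R := T1Lifting.artB k (n + 1)) (S := T1Lifting.artA k (n + 1)) φ b')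
      (T1Lifting.gC_comp_j k n)).trans hb'2
  · rw [← F.map_comp]
    exact (congrArg (fun φ => F.map (R := T1Lifting.artB k (n + 1)) (S := T1Lifting.artB k n) φ b')
      (T1Lifting.jB_comp_j k n)).trans hb'1

/-- Conversely, under (H₁) the (H4)-form gives back Def. 1.1 (so under (H₄) the T¹-lifting condition «becomes» the
surjectivity of every `F(B_n) → F(C_n)`, [FantechiManetti1999T1Lifting, p. 3, l. 13–21]): a compatible pair
`(b, a) ∈ F(B_n) × F(A_{n+1})` lifts to some `c ∈ F(C_{n+1})` by (H₁) applied to the cartesian square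
`C_{n+1} = B_n ×_{A_n} A_{n+1}` (its side `A_{n+1} → A_n` is a small extension), and `c` lifts to `F(B_{n+1})` by
hypothesis. [cite: FantechiManetti1999T1Lifting, p. 3] -/
theorem ArtinFunctor.t1Lifting_of_t1LiftingH4 (F : ArtinFunctor.{u} k) (h1 : F.H1) (hT : F.T1LiftingH4) :
    F.T1Lifting := by
  intro n b a hab
  obtain ⟨c, hca, hcb⟩ := h1 (R₀ := T1Lifting.artA k n) (R₁ := T1Lifting.artA k (n + 1))
    (R₂ := T1Lifting.artB k n) (R₃ := T1Lifting.artC k (n + 1)) (T1Lifting.i k n) (T1Lifting.bA k n)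
    (T1Lifting.gC k n) (T1Lifting.jB k n) (T1Lifting.isCartesian_gC_jB k n) (T1Lifting.isSmallExtension_i k n)
    a b hab.symm
  obtain ⟨b', hb'⟩ := hT (n + 1) c
  refine ⟨b', ?_, ?_⟩
  · have h := F.map_comp (R := T1Lifting.artB k (n + 1)) (S := T1Lifting.artC k (n + 1))
      (T := T1Lifting.artB k n) (T1Lifting.j k (n + 1)) (T1Lifting.jB k n) b'
    rw [hb', hcb] at h
    exact (congrArg (fun φ => F.map (R := T1Lifting.artB k (n + 1)) (S := T1Lifting.artB k n) φ b')
      (T1Lifting.jB_comp_j k n)).symm.trans h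
  · have h := F.map_comp (R := T1Lifting.artB k (n + 1)) (S := T1Lifting.artC k (n + 1))
      (T := T1Lifting.artA k (n + 1)) (T1Lifting.j k (n + 1)) (T1Lifting.gC k n) b'
    rw [hb', hca] at h
    exact (congrArg (fun φ => F.map (R := T1Lifting.artB k (n + 1)) (S := T1Lifting.artA k (n + 1)) φ b')
      (T1Lifting.gC_comp_j k n)).symm.trans h

/-- **Kawamata's argument, one index at a time** ([FantechiManetti1999T1Lifting, p. 3, l. 21–25]; the same
statement for a pro-representable `D` with an obstruction space is C. Lehn, Dissertation Mainz 2011, Lemma VI.3.7,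
there proved by `T²`-functoriality along `t ↦ t + ε`): if `F` satisfies (H₁), `char k = 0`, and `F(B_m) → F(C_m)` is
onto, then `F(A_{m+1}) → F(A_m)` is onto — the square
`A_{m+1} = B_m ×_{C_m} A_m` is cartesian in characteristic zero (`T1Lifting.isCartesian_fB_i`) and `j : B_m → C_m` is a
small extension, so (H₁) lifts the compatible pair `(b, a)`, `b ↦ f(a)`. [cite: FantechiManetti1999T1Lifting, p. 3] -/
theorem ArtinFunctor.map_i_surjective_of_map_j_surjective [CharZero k] (F : ArtinFunctor.{u} k) (h1 : F.H1)
    (m : ℕ) (hj : Function.Surjective (F.map (R := T1Lifting.artB k m) (S := T1Lifting.artC k m) (T1Lifting.j k m))) :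
    Function.Surjective (F.map (R := T1Lifting.artA k (m + 1)) (S := T1Lifting.artA k m) (T1Lifting.i k m)) := by
  intro a
  obtain ⟨b, hb⟩ := hj (F.map (R := T1Lifting.artA k m) (S := T1Lifting.artC k m) (T1Lifting.fC k m) a)
  obtain ⟨d, -, hd⟩ := h1 (R₀ := T1Lifting.artC k m) (R₁ := T1Lifting.artB k m) (R₂ := T1Lifting.artA k m)
    (R₃ := T1Lifting.artA k (m + 1)) (T1Lifting.j k m) (T1Lifting.fC k m) (T1Lifting.fB k m) (T1Lifting.i k m)
    (T1Lifting.isCartesian_fB_i k m) (T1Lifting.isSmallExtension_j k m) b a hb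
  exact ⟨d, hd⟩

/-- **Kawamata's T¹-lifting theorem in the (H4) form of [FantechiManetti1999T1Lifting, p. 3, l. 20–25]**
(«essentially Kawamata's proof», [Kawamata1992UnobstructedDeformations, Thm. 1]): let `k` be a field of characteristic
zero and `F : Art_k → Sets` a functor of Artin rings satisfying Schlessinger's (H₁). If `F(B_n) → F(C_n)` is onto for
every `n`, then `F(A_{m+1}) → F(A_m)` is surjective for every `m`: `F` has no obstructions along the curvilinear
extensions `k[t]/(t^{m+2}) → k[t]/(t^{m+1})`. [cite: FantechiManetti1999T1Lifting, p. 3] -/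
theorem ArtinFunctor.map_i_surjective_of_t1LiftingH4 [CharZero k] (F : ArtinFunctor.{u} k) (h1 : F.H1)
    (hT : F.T1LiftingH4) (m : ℕ) :
    Function.Surjective (F.map (R := T1Lifting.artA k (m + 1)) (S := T1Lifting.artA k m) (T1Lifting.i k m)) :=
  F.map_i_surjective_of_map_j_surjective h1 m (hT m)

/-- **The T¹-lifting theorem for functors with (H4), as printed** ([FantechiManetti1999T1Lifting, Def. 1.1 and p. 3,
l. 13–25]; = [Kawamata1992UnobstructedDeformations, Thm. 1] for pro-representable `F`, whose hypotheses imply (H₄)):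
let `k` be a field of characteristic zero and `F : Art_k → Sets` a functor of Artin rings satisfying (H₄)
([FantechiManetti1998ObstructionCalculus, Def. 2.7]) with the T¹-lifting property (Def. 1.1). Then
`F(A_{m+2}) → F(A_{m+1})` is surjective for every `m`, i.e. «`F(A_{m+1}) → F(A_m)` is surjective for every integer
`m ≥ 1`» (p. 3, l. 3–4). (Smoothness of `F` then follows by [FantechiManetti1998ObstructionCalculus, Cor. 6.4 / 6.15],
not formalised here.) [cite: FantechiManetti1999T1Lifting, p. 3] -/
theorem ArtinFunctor.map_i_succ_surjective_of_t1Lifting [CharZero k] (F : ArtinFunctor.{u} k) (h4 : F.H4)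
    (hT : F.T1Lifting) (m : ℕ) :
    Function.Surjective
      (F.map (R := T1Lifting.artA k (m + 2)) (S := T1Lifting.artA k (m + 1)) (T1Lifting.i k (m + 1))) :=
  F.map_i_surjective_of_map_j_surjective h4.h1 (m + 1) (F.map_j_succ_surjective_of_t1Lifting h4 hT m)

end Functors

end Literature.AlgebraicGeometry.Deformation
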